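import Literature.Geometry.Kaehler.HolomorphicChainLelongSemicontinuity
import Literature.Geometry.Kaehler.HolomorphicChainLelongFunction
import HarnessLib

/-!
# Upper level sets of the Lelong number along weak limits of positive holomorphic chains

Layer `Literature/Geometry/Kaehler`; lane `lit-hodgefound`, seat p07, programme «MINIMALITY & MASS»,
file F8. For a holomorphic `p`-chain `T = Σ k_Z Z` on `Ω` (`p = q + 1`) write
`n([T], a) = Σ_Z |k_Z| n(Z, a)` (`∑ᶠ Z, |k_Z| · lelongNumber Z p a`) and
`E_m(T) = {a ∈ Ω : n([T], a) ≥ m}` (closed in `Ω`, `HolomorphicChainLelongFunction.lean`;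
`E_1(T) = |T|`). From the joint upper semicontinuity of the Lelong number
(`HolomorphicChain.limsup_finsum_lelongNumber_le_of_tendsto_of_tendsto`, file F4 =
`HolomorphicChainLelongSemicontinuity.lean`, [Chirka1989, §16.1 Prop. 1 (proof)]): if the `T_j`
are positive chains with `[T_j] → [T]` in the sense of currents, then

* `HolomorphicChain.le_finsum_lelongNumber_of_tendsto_of_frequently_le` — `a_j → a ∈ Ω` and
  `n([T_j], a_j) ≥ m` for infinitely many `j` imply `n([T], a) ≥ m`;
* `HolomorphicChain.mem_levelSet_of_tendsto_of_frequently_mem` — the same for the level sets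
  `E_m`: limits of points of `E_m(T_j)` lie in `E_m(T)`;
* `HolomorphicChain.mem_levelSet_of_mem_limitSet` — **every point of `Ω` lying in all the closures
  `cl(⋃_{j ≥ N} E_m(T_j))` lies in `E_m(T)`** ("`lim E_m(T_j) ⊆ E_m(T)`"); for `m = 1` this is the
  inclusion `lim |T_j| ⊆ |T|` of [Chirka1989, §16.1 Prop. 1, last clause]
  (`HolomorphicChain.mem_image_support_of_mem_limitSet_of_mult_nonneg`, here recovered as
  `HolomorphicChain.mem_support_of_mem_limitSet_support`).

Theorems only; no new definitions, no named facts.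

## References

* [Chirka1989] E. M. Chirka, *Complex Analytic Sets*, Kluwer 1989, §11.1 (p. 120), §16.1 Prop. 1
  and its proof (pp. 206–207) (held `book:chirkand-complex-analytic-sets`, PDF p0214–p0215).
-/

noncomputable section

open scoped Manifold Topology ENNReal NNReal Distributions
open Set Filter MeasureTheory Metric Function TopologicalSpace

namespace Literature.Geometry.Kaehler

open Literature.Geometry.GeometricMeasureTheory

-- Nested operator-norm instances on (duals of) `V [⋀^Fin n]→L[ℝ] ℝ`.
set_option maxSynthPendingDepth 2

universe u

variable {V : Type u} [NormedAddCommGroup V] [InnerProductSpace ℂ V] [FiniteDimensional ℂ V]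
  [MeasurableSpace V] [BorelSpace V] {Ω : Opens V} {q : ℕ}

namespace HolomorphicChain

section Convergence

variable (T : ℕ → HolomorphicChain 𝓘(ℂ, V) Ω (q + 1)) {T' : HolomorphicChain 𝓘(ℂ, V) Ω (q + 1)}

/-- **Lelong numbers `≥ m` persist in the limit**: if the `T_j` are positive `p`-chains with
`[T_j] → [T]` in the sense of currents, `a_j → a ∈ Ω`, and `n([T_j], a_j) ≥ m` for infinitely many
`j`, then `n([T], a) ≥ m` (`m ≤ limsup_j n([T_j], a_j) ≤ n([T], a)`).
[cite: Chirka1989, §16.1 Prop. 1 (proof), p. 207] -/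
theorem le_finsum_lelongNumber_of_tendsto_of_frequently_le (hpos : ∀ j Z, 0 ≤ (T j).mult Z)
    (hconv : ∀ ψ, Tendsto (fun j => (T j).toCurrent ψ) atTop (𝓝 (T'.toCurrent ψ)))
    {c : ℕ → V} {a : V} (ha : a ∈ (Ω : Set V)) (hc : Tendsto c atTop (𝓝 a)) {m : ℝ≥0∞}
    (hm : ∃ᶠ j in atTop,
      m ≤ ∑ᶠ Z : Set Ω, ENNReal.ofReal |((T j).mult Z : ℝ)| * lelongNumber Z (q + 1) (c j)) :
    m ≤ ∑ᶠ Z : Set Ω, ENNReal.ofReal |(T'.mult Z : ℝ)| * lelongNumber Z (q + 1) a :=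
  (le_limsup_of_frequently_le hm).trans
    (limsup_finsum_lelongNumber_le_of_tendsto_of_tendsto T hpos hconv ha hc)

/-- **Limits of points of `E_m(T_j)` lie in `E_m(T)`**: with `E_m(S) = {x ∈ Ω : n([S], x) ≥ m}`,
if `w_j → w` in `Ω` and `w_j ∈ E_m(T_j)` for infinitely many `j` then `w ∈ E_m(T)`.
[cite: Chirka1989, §16.1 Prop. 1 (proof), p. 207; §11.1, p. 120] -/
theorem mem_levelSet_of_tendsto_of_frequently_mem (hpos : ∀ j Z, 0 ≤ (T j).mult Z)
    (hconv : ∀ ψ, Tendsto (fun j => (T j).toCurrent ψ) atTop (𝓝 (T'.toCurrent ψ)))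
    {w : ℕ → Ω} {w' : Ω} (hw : Tendsto w atTop (𝓝 w')) {m : ℝ≥0∞}
    (hm : ∃ᶠ j in atTop, w j ∈ {x : Ω |
      m ≤ ∑ᶠ Z : Set Ω, ENNReal.ofReal |((T j).mult Z : ℝ)| * lelongNumber Z (q + 1) (x : V)}) :
    w' ∈ {x : Ω |
      m ≤ ∑ᶠ Z : Set Ω, ENNReal.ofReal |(T'.mult Z : ℝ)| * lelongNumber Z (q + 1) (x : V)} :=
  le_finsum_lelongNumber_of_tendsto_of_frequently_le T hpos hconv w'.2
    ((continuous_subtype_val.tendsto w').comp hw) hm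

/-- **`lim E_m(T_j) ⊆ E_m(T)`**: if the `T_j` are positive `p`-chains with `[T_j] → [T]` in the
sense of currents and `x ∈ Ω` lies in `cl(⋃_{j ≥ N} E_m(T_j))` for every `N`
(`E_m(S) = {n([S], ·) ≥ m}`, viewed in `V`), then `n([T], x) ≥ m`: choose `j_k ≥ k` and
`x_k ∈ E_m(T_{j_k})` with `|x_k - x| < 1/(k+1)` and apply the previous statement to the subsequence.
[cite: Chirka1989, §16.1 Prop. 1 (proof), p. 207; §11.1, p. 120] -/
theorem mem_levelSet_of_mem_limitSet (hpos : ∀ j Z, 0 ≤ (T j).mult Z)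
    (hconv : ∀ ψ, Tendsto (fun j => (T j).toCurrent ψ) atTop (𝓝 (T'.toCurrent ψ)))
    {m : ℝ≥0∞} {x : V} (hxΩ : x ∈ (Ω : Set V))
    (hx : ∀ N : ℕ, x ∈ closure (⋃ j ≥ N, {y : V | y ∈ (Ω : Set V) ∧
      m ≤ ∑ᶠ Z : Set Ω, ENNReal.ofReal |((T j).mult Z : ℝ)| * lelongNumber Z (q + 1) y})) :
    m ≤ ∑ᶠ Z : Set Ω, ENNReal.ofReal |(T'.mult Z : ℝ)| * lelongNumber Z (q + 1) x := by
  -- a subsequence `φ k ≥ k` and points `c k ∈ E_m(T_{φ k})` with `dist (c k) x < 1/(k+1)`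
  have hchoice : ∀ k : ℕ, ∃ j, k ≤ j ∧ ∃ y : V, dist y x < 1 / ((k : ℝ) + 1) ∧
      m ≤ ∑ᶠ Z : Set Ω, ENNReal.ofReal |((T j).mult Z : ℝ)| * lelongNumber Z (q + 1) y := by
    intro k
    have hk : (0 : ℝ) < 1 / ((k : ℝ) + 1) := by positivity
    obtain ⟨y, hy, hyU⟩ := Metric.mem_closure_iff.1 (hx k) _ hk
    simp only [mem_iUnion, mem_setOf_eq, exists_prop] at hy
    obtain ⟨j, hj, -, hjy⟩ := hy
    exact ⟨j, hj, y, by rwa [dist_comm] at hyU, hjy⟩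
  choose φ hφ c hc hcm using hchoice
  have hφt : Tendsto φ atTop atTop := tendsto_atTop_mono hφ tendsto_id
  -- the subsequence converges to the same limit, positively
  have hconv' : ∀ ψ, Tendsto (fun k => (T (φ k)).toCurrent ψ) atTop (𝓝 (T'.toCurrent ψ)) :=
    fun ψ => (hconv ψ).comp hφt
  have hct : Tendsto c atTop (𝓝 x) := by
    rw [Metric.tendsto_atTop]
    intro ε hε
    obtain ⟨N, hN⟩ := exists_nat_one_div_lt hε
    refine ⟨N, fun k hk => (hc k).trans_le ?_⟩
    calc 1 / ((k : ℝ) + 1) ≤ 1 / ((N : ℝ) + 1) := by gcongr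
      _ ≤ ε := hN.le
  exact le_finsum_lelongNumber_of_tendsto_of_frequently_le (fun k => T (φ k))
    (fun k Z => hpos (φ k) Z) hconv' hxΩ hct (Frequently.of_forall hcm)

/-- The case `m = 1`: **`lim |T_j| ⊆ |T|`** for positive chains (`E_1(S) = |S|`,
`HolomorphicChain.support_eq_preimage_finsum_lelongNumber_Ici`) — another road to
`HolomorphicChain.mem_image_support_of_mem_limitSet_of_mult_nonneg`.
[cite: Chirka1989, §16.1 Prop. 1, p. 207] -/
theorem mem_support_of_mem_limitSet_support (hpos : ∀ j Z, 0 ≤ (T j).mult Z)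
    (hconv : ∀ ψ, Tendsto (fun j => (T j).toCurrent ψ) atTop (𝓝 (T'.toCurrent ψ)))
    {w : Ω} (hw : ∀ N : ℕ, (w : V) ∈ closure (⋃ j ≥ N, (((↑) : Ω → V) '' (T j).support : Set V))) :
    w ∈ T'.support := by
  rw [T'.support_eq_preimage_finsum_lelongNumber_Ici, mem_preimage, mem_preimage, mem_Ici]
  refine mem_levelSet_of_mem_limitSet T hpos hconv w.2 fun N => closure_mono ?_ (hw N)
  refine iUnion₂_mono fun j _ => ?_
  rintro _ ⟨w', hw', rfl⟩
  exact ⟨w'.2, (T j).one_le_finsum_lelongNumber_of_mem_support hw'⟩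

end Convergence

end HolomorphicChain

end Literature.Geometry.Kaehler
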